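import Summits.CriticalPhenomena.CardyFormulaZ2.Theorems.CardySelfRefinementCriticalPathRSWStubFiniteSizeCriteriaGeometry

/-!
# Finite-size criteria for `M_k`, part 3: grids

Support file for item `stmt-CriticalPhenomena-10267` (route `CardySelfRefinement`, crux
`CriticalPathRSW`, line finite-size-envelope, stub `stub_finiteSizeCriteria`): the finite-size
criteria (H. Kesten, *Percolation theory for mathematicians* (1982), Ch. 5, Thm. 5.1; G. Grimmett,
*Percolation* (1999), §11.7) for the `k`-dependent self-refinement laws `M_k(ρ, c)` and their duals.

The grid `2Nℤ²` of centres of the renormalisation (Kesten 1982, Lemma 5.2): rounding to the grid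
(`abs_sub_grid_le`, `grid_index_mem`), the annulus event of the grid forced by a long horizontal
crossing (`exists_annulusCross_of_hCross`), and the two grid annulus events `A(y; N, 4N)`,
`A(y'; N, 4N)`, `17N ≤ ‖y‖∞ ≤ 19N`, `‖y'‖∞ ≤ 6N`, forced by `A(0; 6N, 24N)`
(`exists_pair_of_annulusCross`).  Path-wise statements only.
-/

noncomputable section

namespace Summit.CriticalPhenomena.CardyFormulaZ2.Cruxes.CriticalPathRSW.FiniteSizeEnvelope

open Set
open Literature.Probability.LatticeModels Literature.Probability.Percolation

namespace FSC

/-! ### Rectangles and crossing events (local notations)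

To keep these support files free of new definitions, the four events of the argument are local
notations for explicit instances of the tree's `openCrossing S A B`:

* `rect[a, b, lo, hi]` — the lattice rectangle `[a, b] × [lo, hi] ∩ ℤ²` (a `Finset`, Mathlib's
  order interval of `Site 2 = Fin 2 → ℤ`);
* `hCross[a, b, lo, hi]` — its **horizontal open crossing**: an open path inside the rectangle from
  the left side `{x₀ = a}` to the right side `{x₀ = b}`;
* `vCross[a, b, lo, hi]` — its **vertical open crossing**, from `{x₁ = lo}` to `{x₁ = hi}`;
* `annulusCross[c, N, R]` — the **annulus event** `A(c; N, R)` of Kesten (1982), Ch. 5: an open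
  path inside the box `c + [-R, R]²` from the box `c + [-N, N]²` to the boundary of `c + [-R, R]²`. -/

local notation3 "rect[" a ", " b ", " lo ", " hi "]" =>
  (Finset.Icc ![(a : ℤ), (lo : ℤ)] ![(b : ℤ), (hi : ℤ)] : Finset (Site 2))

local notation3 "hCross[" a ", " b ", " lo ", " hi "]" =>
  (openCrossing (↑(Finset.Icc ![(a : ℤ), (lo : ℤ)] ![(b : ℤ), (hi : ℤ)] : Finset (Site 2)) : Set (Site 2))
    {x : Site 2 | x ∈ (Finset.Icc ![(a : ℤ), (lo : ℤ)] ![(b : ℤ), (hi : ℤ)] : Finset (Site 2)) ∧ x 0 = (a : ℤ)}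
    {x : Site 2 | x ∈ (Finset.Icc ![(a : ℤ), (lo : ℤ)] ![(b : ℤ), (hi : ℤ)] : Finset (Site 2)) ∧ x 0 = (b : ℤ)} :
    Set (BondConfig (Site 2)))

local notation3 "vCross[" a ", " b ", " lo ", " hi "]" =>
  (openCrossing (↑(Finset.Icc ![(a : ℤ), (lo : ℤ)] ![(b : ℤ), (hi : ℤ)] : Finset (Site 2)) : Set (Site 2))
    {x : Site 2 | x ∈ (Finset.Icc ![(a : ℤ), (lo : ℤ)] ![(b : ℤ), (hi : ℤ)] : Finset (Site 2)) ∧ x 1 = (lo : ℤ)}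
    {x : Site 2 | x ∈ (Finset.Icc ![(a : ℤ), (lo : ℤ)] ![(b : ℤ), (hi : ℤ)] : Finset (Site 2)) ∧ x 1 = (hi : ℤ)} :
    Set (BondConfig (Site 2)))

local notation3 "annulusCross[" c ", " N ", " R "]" =>
  (openCrossing
    (↑(Finset.Icc ![(c : Site 2) 0 - ((R : ℕ) : ℤ), (c : Site 2) 1 - ((R : ℕ) : ℤ)]
        ![(c : Site 2) 0 + ((R : ℕ) : ℤ), (c : Site 2) 1 + ((R : ℕ) : ℤ)] : Finset (Site 2)) : Set (Site 2))
    (↑(Finset.Icc ![(c : Site 2) 0 - ((N : ℕ) : ℤ), (c : Site 2) 1 - ((N : ℕ) : ℤ)]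
        ![(c : Site 2) 0 + ((N : ℕ) : ℤ), (c : Site 2) 1 + ((N : ℕ) : ℤ)] : Finset (Site 2)) : Set (Site 2))
    {x : Site 2 | x ∈ (Finset.Icc ![(c : Site 2) 0 - ((R : ℕ) : ℤ), (c : Site 2) 1 - ((R : ℕ) : ℤ)]
        ![(c : Site 2) 0 + ((R : ℕ) : ℤ), (c : Site 2) 1 + ((R : ℕ) : ℤ)] : Finset (Site 2)) ∧
      (x 0 = (c : Site 2) 0 - ((R : ℕ) : ℤ) ∨ x 0 = (c : Site 2) 0 + ((R : ℕ) : ℤ) ∨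
        x 1 = (c : Site 2) 1 - ((R : ℕ) : ℤ) ∨ x 1 = (c : Site 2) 1 + ((R : ℕ) : ℤ))} :
    Set (BondConfig (Site 2)))

/-! ### Grids of step `2N` -/

/-- Rounding to the grid `2Nℤ`: every integer `t` is within `N` of `2N ⌊(t + N) / 2N⌋`. -/
theorem abs_sub_grid_le (N : ℕ) (hN : 0 < N) (t : ℤ) :
    -(N : ℤ) ≤ t - 2 * N * ((t + N) / (2 * N)) ∧ t - 2 * N * ((t + N) / (2 * N)) < N := by
  have h2N : (0 : ℤ) < 2 * N := by positivity
  have h1 := Int.mul_ediv_add_emod (t + N) (2 * N)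
  have h2 := Int.emod_nonneg (t + N) h2N.ne'
  have h3 := Int.emod_lt_of_pos (t + N) h2N
  constructor <;> linarith

/-- Locating a grid index: `A ≤ ⌊(t + N)/2N⌋ ≤ B` from `2N·A ≤ t + N < 2N·(B + 1)`. -/
theorem grid_index_mem {N : ℕ} (hN : 0 < N) {t A B : ℤ} (hlo : A * (2 * N) ≤ t + N)
    (hhi : t + N < (B + 1) * (2 * N)) : A ≤ (t + N) / (2 * N) ∧ (t + N) / (2 * N) ≤ B := by
  have h2N : (0 : ℤ) < 2 * N := by positivity
  exact ⟨(Int.le_ediv_iff_mul_le h2N).2 hlo, Int.lt_add_one_iff.1 ((Int.ediv_lt_iff_lt_mul h2N).2 hhi)⟩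

/-- **A long horizontal crossing contains an annulus event of the grid.** If `[a, b] × [lo, hi]`
is crossed horizontally, `|a - y₀| ≤ N` and `y₀ + R ≤ b`, then `A(y; N, R)` occurs for the grid
point `y = (y₀, 2N q)` nearest to the starting point of the crossing (`N ≤ R`). -/
theorem exists_annulusCross_of_hCross {ω : BondConfig (Site 2)} (hω : ω ⊆ (zdGraph 2).edgeSet)
    {a b lo hi : ℤ} {N R : ℕ} (hN : 0 < N) (hNR : N ≤ R) {y₀ : ℤ} (hy₀ : |a - y₀| ≤ N)
    (hb : y₀ + R ≤ b) (h : ω ∈ hCross[a, b, lo, hi]) :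
    ∃ q : ℤ, (lo + N) / (2 * N) ≤ q ∧ q ≤ (hi + N) / (2 * N) ∧
      ω ∈ annulusCross[![y₀, 2 * N * q], N, R] := by
  obtain ⟨s, ⟨hs, hs0⟩, e, ⟨he, he0⟩, hconn⟩ := h
  obtain ⟨w, -, hwω⟩ := exists_walk_of_mem_openConnIn hω hconn
  rw [mem_rect] at hs he
  have h2N : (0 : ℤ) < 2 * N := by positivity
  refine ⟨(s 1 + N) / (2 * N), Int.ediv_le_ediv h2N (by omega), Int.ediv_le_ediv h2N (by omega), ?_⟩
  have hround := abs_sub_grid_le N hN (s 1)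
  rw [abs_le] at hy₀
  refine mem_annulusCross_of_walk w hwω ?_ hNR ?_
  · rw [mem_rect]
    simp only [Matrix.cons_val_zero, Matrix.cons_val_one]
    omega
  · left
    simp only [Matrix.cons_val_zero]
    rw [le_abs']
    omega

/-- **Renormalisation geometry** (Kesten 1982, Lemma 5.2): on a lattice configuration, the annulus
event `A(0; 6N, 24N)` forces two annulus events `A(y; N, 4N)`, `A(y'; N, 4N)` of the grid `2Nℤ²`
with `17N ≤ ‖y‖∞`, `y ∈ 2N·[-9, 9]²` and `y' ∈ 2N·[-3, 3]²` (the grid points nearest to the first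
vertex of the path at sup-norm `18N` and to its starting point). -/
theorem exists_pair_of_annulusCross {ω : BondConfig (Site 2)} (hω : ω ⊆ (zdGraph 2).edgeSet)
    {N : ℕ} (hN : 0 < N) (h : ω ∈ annulusCross[0, (6 * N), (24 * N)]) :
    ∃ q₀ q₁ q₀' q₁' : ℤ, (-9 ≤ q₀ ∧ q₀ ≤ 9 ∧ -9 ≤ q₁ ∧ q₁ ≤ 9) ∧
      (17 * (N : ℤ) ≤ |2 * N * q₀| ∨ 17 * (N : ℤ) ≤ |2 * N * q₁|) ∧
      (-3 ≤ q₀' ∧ q₀' ≤ 3 ∧ -3 ≤ q₁' ∧ q₁' ≤ 3) ∧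
      ω ∈ annulusCross[![2 * N * q₀, 2 * N * q₁], N, (4 * N)] ∧
      ω ∈ annulusCross[![2 * N * q₀', 2 * N * q₁'], N, (4 * N)] := by
  obtain ⟨s, hs, e, ⟨he, hesph⟩, hconn⟩ := h
  obtain ⟨w, -, hwω⟩ := exists_walk_of_mem_openConnIn hω hconn
  rw [Finset.mem_coe, mem_rect] at hs
  rw [mem_rect] at he
  simp only [Pi.zero_apply, zero_sub, zero_add] at hs he hesph
  push_cast at hs he hesph
  have hN4 : N ≤ 4 * N := by omega
  have hr0 := abs_sub_grid_le N hN (s 0)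
  have hr1 := abs_sub_grid_le N hN (s 1)
  -- the inner event, around the starting point
  have hin : ω ∈ annulusCross[![2 * N * ((s 0 + N) / (2 * N)), 2 * N * ((s 1 + N) / (2 * N))], N, (4 * N)] := by
    refine mem_annulusCross_of_walk w hwω ?_ hN4 ?_
    · rw [mem_rect]
      simp only [Matrix.cons_val_zero, Matrix.cons_val_one]
      omega
    · simp only [Matrix.cons_val_zero, Matrix.cons_val_one]
      rw [le_abs', le_abs']
      push_cast
      omega
  -- the outer event, around the first vertex at sup-norm `18N`
  have hPs : ¬ (18 * (N : ℤ) ≤ |s 0| ∨ 18 * (N : ℤ) ≤ |s 1|) := by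
    rw [le_abs', le_abs']; omega
  have hPe : 18 * (N : ℤ) ≤ |e 0| ∨ 18 * (N : ℤ) ≤ |e 1| := by
    rw [le_abs', le_abs']; omega
  obtain ⟨a, b, q, hadj, r, hw, hq, hb⟩ :=
    exists_first_sat (fun t : Site 2 => 18 * (N : ℤ) ≤ |t 0| ∨ 18 * (N : ℤ) ≤ |t 1|) w hPs hPe
  have ha : ¬ (18 * (N : ℤ) ≤ |a 0| ∨ 18 * (N : ℤ) ≤ |a 1|) := hq a q.end_mem_support
  simp only [not_or, not_le, abs_lt] at ha
  have hst0 := sub_le_one_of_adj hadj 0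
  have hst1 := sub_le_one_of_adj hadj 1
  have hb' := hb
  rw [le_abs', le_abs'] at hb'
  have hrb0 := abs_sub_grid_le N hN (b 0)
  have hrb1 := abs_sub_grid_le N hN (b 1)
  have hout : ω ∈ annulusCross[![2 * N * ((b 0 + N) / (2 * N)), 2 * N * ((b 1 + N) / (2 * N))], N, (4 * N)] := by
    refine mem_annulusCross_of_walk r (fun x hx => hwω x (mem_edges_of_mem_edges_cons hw ?_)) ?_ hN4 ?_
    · rw [SimpleGraph.Walk.edges_cons]
      exact List.mem_cons_of_mem _ hx
    · rw [mem_rect]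
      simp only [Matrix.cons_val_zero, Matrix.cons_val_one]
      omega
    · simp only [Matrix.cons_val_zero, Matrix.cons_val_one]
      rw [le_abs', le_abs']
      push_cast
      omega
  refine ⟨(b 0 + N) / (2 * N), (b 1 + N) / (2 * N), (s 0 + N) / (2 * N), (s 1 + N) / (2 * N),
    ?_, ?_, ?_, hout, hin⟩
  · have h0 := grid_index_mem hN (t := b 0) (A := -9) (B := 9) (by omega) (by omega)
    have h1 := grid_index_mem hN (t := b 1) (A := -9) (B := 9) (by omega) (by omega)
    exact ⟨h0.1, h0.2, h1.1, h1.2⟩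
  · rw [le_abs', le_abs']
    omega
  · have h0 := grid_index_mem hN (t := s 0) (A := -3) (B := 3) (by omega) (by omega)
    have h1 := grid_index_mem hN (t := s 1) (A := -3) (B := 3) (by omega) (by omega)
    exact ⟨h0.1, h0.2, h1.1, h1.2⟩

/-- **Headline of this support file** (registered sub-stub `stub_finiteSizeCriteria_grids` of
`stub_finiteSizeCriteria`): rounding to the grid `2Nℤ` moves an integer by at most `N` (`abs_sub_grid_le`). -/
theorem stub_finiteSizeCriteria_grids :
    ∀ (N : ℕ), 0 < N → ∀ t : ℤ, -(N : ℤ) ≤ t - 2 * N * ((t + N) / (2 * N)) ∧ t - 2 * N * ((t + N) / (2 * N)) < N :=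
  fun N hN t => abs_sub_grid_le N hN t

end FSC

end Summit.CriticalPhenomena.CardyFormulaZ2.Cruxes.CriticalPathRSW.FiniteSizeEnvelope
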